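import Mathlib
import Summits.PneNP.PneNP.Theses.WitnessForging

/-!
# Route WitnessForging — support item `AffineWitnessesForgeable` (stmt-PneNP-2436)

Sanity floor of the forging ladder (XORSAT is correctly easy): every nonempty affine subspace
`V ⊆ 𝔽₂ⁿ` is forged EXACTLY by a polynomial map of total degree `≤ 1`.

Proof. Pick `v₀ ∈ V`, let `W = V.direction` and `b = Module.finBasis (ZMod 2) W` a basis of `W`
indexed by `Fin m`, `m = finrank W`. Put `P i = C (v₀ i) + ∑ j, X j * C (b j i)`. The evaluation
map `r ↦ (eval r (P i))ᵢ = v₀ + ∑ j, r j • b j` is a bijection `𝔽₂ᵐ → V`; hence for every event `E`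
the number of coin strings landing in `E` is `#(V ∩ E)`, and `#V = 2ᵐ`, so the two frequencies
`#{r | P(r) ∈ E} / 2ᵐ` and `#(V ∩ E) / #V` agree. [folklore]
-/

set_option linter.dupNamespace false -- `Summit.PneNP.PneNP.…`: summit = sub-problem (D-0017)

namespace Summit.PneNP.PneNP.Theorems

open MvPolynomial

/-- **`AffineWitnessesForgeable` holds** (route `WitnessForging`, item stmt-PneNP-2436): for
every nonempty affine subspace `V` of `Fin n → ZMod 2` there are `m` and polynomials `P i`
(`i : Fin n`) in `m` variables of total degree `≤ 1` such that the pushforward of the uniform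
measure on `Fin m → ZMod 2` under `r ↦ (eval r (P i))ᵢ` is the uniform measure on `V`: every event
has the same frequency on both sides. Affine parametrisation of `V` by a basis of its direction.
[folklore] -/
theorem affineWitnessesForgeable_proof :
    Summit.PneNP.PneNP.Theses.WitnessForging.AffineWitnessesForgeable := by
  unfold Summit.PneNP.PneNP.Theses.WitnessForging.AffineWitnessesForgeable
  intro n V hV
  classical
  obtain ⟨v₀, hv₀⟩ := hV
  have hv₀' : v₀ ∈ V := hv₀
  -- a basis of the direction, indexed by `Fin m`
  set m : ℕ := Module.finrank (ZMod 2) V.direction with hm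
  let b : Module.Basis (Fin m) (ZMod 2) V.direction := Module.finBasis (ZMod 2) V.direction
  -- the affine parametrisation of `V` and its presentation by degree-1 polynomials
  let f : (Fin m → ZMod 2) → (Fin n → ZMod 2) := fun r =>
    v₀ + ((b.equivFun.symm r : V.direction) : Fin n → ZMod 2)
  let P : Fin n → MvPolynomial (Fin m) (ZMod 2) := fun i =>
    C (v₀ i) + ∑ j : Fin m, X j * C ((b j : Fin n → ZMod 2) i)
  have hPf : ∀ r : Fin m → ZMod 2, (fun i => MvPolynomial.eval r (P i)) = f r := by
    intro r
    funext i
    simp only [P, f, map_add, map_sum, map_mul, eval_C, eval_X,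
      Module.Basis.equivFun_symm_apply, Pi.add_apply, Submodule.coe_sum, Submodule.coe_smul,
      Finset.sum_apply, Pi.smul_apply, smul_eq_mul]
  -- `f` is a bijection onto `V`
  have hf_inj : Function.Injective f := by
    intro r₁ r₂ h
    have h' : v₀ + ((b.equivFun.symm r₁ : V.direction) : Fin n → ZMod 2)
        = v₀ + ((b.equivFun.symm r₂ : V.direction) : Fin n → ZMod 2) := h
    exact b.equivFun.symm.injective (Subtype.ext (add_left_cancel h'))
  have hf_mem : ∀ r, f r ∈ V := by
    intro r
    have h := AffineSubspace.vadd_mem_of_mem_direction (b.equivFun.symm r).2 hv₀'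
    rwa [vadd_eq_add, add_comm] at h
  have hf_surj : ∀ v ∈ V, ∃ r, f r = v := by
    intro v hv
    have hw : v - v₀ ∈ V.direction := by
      rw [← vsub_eq_sub]
      exact AffineSubspace.vsub_mem_direction hv hv₀'
    refine ⟨b.equivFun ⟨v - v₀, hw⟩, ?_⟩
    simp only [f, LinearEquiv.symm_apply_apply, Submodule.coe_mk]
    abel
  refine ⟨m, P, ?_, ?_⟩
  · -- total degree ≤ 1
    intro i
    refine (totalDegree_add _ _).trans (max_le ?_ ?_)
    · simp
    · refine totalDegree_finsetSum_le fun j _ => ?_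
      refine (totalDegree_mul _ _).trans ?_
      simp
  · intro E
    -- coin strings landing in `E` ↔ points of `V ∩ E`
    have hcountE :
        (Finset.univ.filter fun r : Fin m → ZMod 2 =>
            (fun i => MvPolynomial.eval r (P i)) ∈ E).card
          = (Finset.univ.filter fun v : Fin n → ZMod 2 =>
              v ∈ (V : Set (Fin n → ZMod 2)) ∧ v ∈ E).card := by
      refine Finset.card_bij (fun r _ => f r) ?_ ?_ ?_
      · intro r hr
        simp only [Finset.mem_filter, Finset.mem_univ, true_and] at hr ⊢
        rw [hPf] at hr
        exact ⟨hf_mem r, hr⟩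
      · intro r₁ _ r₂ _ h
        exact hf_inj h
      · intro v hv
        simp only [Finset.mem_filter, Finset.mem_univ, true_and] at hv
        obtain ⟨r, hr⟩ := hf_surj v hv.1
        refine ⟨r, ?_, hr⟩
        simp only [Finset.mem_filter, Finset.mem_univ, true_and]
        rw [hPf, hr]
        exact hv.2
    -- `#V = 2 ^ m`
    have hcountV :
        (Finset.univ.filter fun v : Fin n → ZMod 2 => v ∈ (V : Set (Fin n → ZMod 2))).card
          = 2 ^ m := by
      have h1 : (Finset.univ : Finset (Fin m → ZMod 2)).card
          = (Finset.univ.filter fun v : Fin n → ZMod 2 => v ∈ (V : Set (Fin n → ZMod 2))).card := by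
        refine Finset.card_bij (fun r _ => f r) ?_ ?_ ?_
        · intro r _
          simp only [Finset.mem_filter, Finset.mem_univ, true_and]
          exact hf_mem r
        · intro r₁ _ r₂ _ h
          exact hf_inj h
        · intro v hv
          simp only [Finset.mem_filter, Finset.mem_univ, true_and] at hv
          obtain ⟨r, hr⟩ := hf_surj v hv
          exact ⟨r, Finset.mem_univ _, hr⟩
      rw [← h1, Finset.card_univ, Fintype.card_fun, ZMod.card, Fintype.card_fin]
    rw [hcountE, hcountV]
    push_cast
    rfl

end Summit.PneNP.PneNP.Theorems
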